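import Literature.MathematicalPhysics.QuantumFieldTheory.Balaban1983to89.B9SmoothHolderClassTGradientTools

/-!
# `Balaban1983to89.B9SmoothHolderClassTFromGradient` — INTO the transported Hölder class `bHZT (U(Γ)) ε p` from a SUP member and a GRADIENT member:
# print's mean-value step «|Ψ(z) − R(U(Γ_{z,z′}))Ψ(z′)| ≦ |Γ_{z,z′}|·sup_Γ|∇_UΨ|» read in coordinates through def-Y's taxicab contour, with the honest `(Lʲη)^{1−ε}` gain
# of (3.43); the PRINT-WEIGHTED form `(Lʲη)^{s−1}‖·‖_{bHZT s s}` (balanced sup∕seminorm channels) and the certificate's `(Lʲη)⁻¹`-weighted graded pin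

T. Bałaban, *Propagators for lattice gauge theories in a background field*, Commun. Math. Phys. **99** (1985) 389–434
[`Balaban1985BackgroundPropagators`, "B9"]; [4] = T. Bałaban, *Propagators and renormalization transformations for lattice gauge
theories. II*, Commun. Math. Phys. **96** (1984) 223–250 [`Balaban1984PropagatorsII`].

statement-level skeleton of published theorems with citation tags; proofs where landed; nothing here is a claim about the
Yang–Mills mass gap

THE PRINTED LOCI (held text `paper:balaban1985-cmp99-background-propagators`, pp. 397–398 re-read).  (3.39)–(3.40) p. 397: the sup norms `|A|, |∇A|` and the Hölder
norms *"‖A‖_α = max sup_{x,x′:|x−x′|≦1} |x − x′|^{−α}|R(U(Γ_{x,x′}))A(x′) − A(x)| … where Γ_{x,x′} is a shortest contour connecting points x and x′.  It is understood that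
the η-scale is used in the above definitions.  If we use another scale, then it is indicated explicitly by a superscript"*; Thm 3.1 (3.42)–(3.43) pp. 397–398:
*"|(G′(U)λ)(x)|, |(∇_UG′(U)λ)(x)|, … ≦ B₀{(Lʲη)², Lʲη, …}e^{−δ₀d(y,y′)}|λ|"*, *"‖ζ∇_UG′(U)λ‖_β, ‖ζG′(U)∇\*_Uλ‖_β ≦ B₀(β)(Lʲη)^{1−β}(…)e^{−δ₀d(y,y′)}|λ|"*; (3.44)–(3.45):
the input functional *"(‖λ‖^{ξ′}_ε + |λ|)"* at the SCALE `ξ′` of the source block; (3.3) p. 390–391 (`D_U = η⁻¹∇_U` on the η-lattice); p. 423 (Thm 3.12): the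
zeroth-order Hölder member read off the sup bounds by the mean-value step along `Γ_{x,x′}`; [4] (2.51)–(2.54) pp. 232–233, (2.1)–(2.2) p. 224, (2.46) p. 231.

WHY THIS FILE (cell `pub-ymgap`, node N06, seat dag-n06-l g24; the «producers INTO `bH13`» programme of `PRODUCERS-INTO-BH13-MEMO.md` and the located units defect U6
of `BH13-UNITS-MEMO.md`).  The N06 certificate's option-(2) pin reads the rows-20–21 Hölder INTERMEDIATE of the gauge modes as a transported smooth-partition class
(`B9SmoothHolderClassT.bHZT (taxiS U) ε p`, graded `…Graded.bHZG`, my g21 files); its PRODUCERS (`Letters313DZ.rgdH : R∇\*_UG₁`, `Letters3131H.tbH ∕ tb₂H`) were left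
DISPLAYED — `…TClosure` §4 closes the BOND class from a probe member, but the site probe pin reads same-block pairs only.  Print produces such Hölder members from SUP
bounds: the sup of the output ((3.42)) and the sup of its COVARIANT GRADIENT ((3.44)-type words), by telescoping along the shortest contour.  The tree holds every
ingredient (dag-n06-w6 `B9Eq340TaxiTelescope`, dag-n06-c `B9Eq340CovariantLipschitzY ∕ …HolderLipParSymY`, node00-def-Y `OpsYNablaBridge.gradY_apply_eq_cdS` and the
gradient model `OpsYSectDCoords.DvcoKH`, dag-n06-w6 LAYER B `B9MultiscaleSmoothPartitionYNear`).  THIS FILE assembles them, for ANY source class, ANY exponents: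
* §1–§3 of the programme (chart dictionary, telescope in coordinates, rung geometry) are `B9SmoothHolderClassTGradientTools`;
* §4 ★★★ `hasMaj_into_bHZT_of_grad` — `T : b₁ → 𝔠^{(−h)}` (sites) and `D_U∘T : b₁ → 𝔠^{(−g)}` (bonds), `h − p = t`, `(1−ε) + g = t`, unitary-like links ⟹
  `HasMaj b₁ (bHZT (taxiS U) ε p) T ((L^{|h|}C₀e^{δr} + L^{(1−ε)+2|g|}(d+1)c_bC₁e^{δr₂})·(Lʲη)^t·e^{−δd})` — sup part as `…TClosure` §4, pair part by §2 with
  `(η|z−z′|_T)^{−ε}·|z−z′|_T·η = (η|z−z′|_T)^{1−ε} ≤ (L·Lʲη)^{1−ε}` (the gain of (3.43), kept), rung blocks by §3;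
* §5 `hasMaj_cNormR_of_exponent_le` (`𝔠^{(a)} ⊂ 𝔠^{(a′)}` for `a ≤ a′`), ★★ `hasMaj_into_bHZT_of_grad_near` (radii discharged by `hβ1`), ★★★
  `hasMaj_into_bHZT_printWeight_of_grad` — INTO `weightNorm (bHZT (taxiS U) s s) (Wscl (1−s))`, the size `(Lʲη)⁻¹sup + (Lʲη)^{s−1}‖·‖_{s,η}` whose unit ball is EXACTLY
  print's `‖F‖^{ξ}_s + |F| ≤ 2Lʲη`, from a `𝔠^{(−1)}` sup member and a `𝔠⁽⁰⁾` gradient member, constant `L·(…)` UNIFORM IN `s ∈ [0,1]` ((3.43) as a class statement; the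
  producer shape of the print-weighted pin (P2′) of `BH13-UNITS-MEMO.md`), ★★ `hasMaj_into_pinLenInv_of_grad` — INTO the certificate's pin (P2)
  `weightNorm (bHZG (taxiS U) (p:=1) w) (Lʲη)⁻¹` from a `𝔠^{(−2)}` sup member and a `𝔠^{(−1)}` gradient member (the dimensionless words `T_b, T_b₂` on `𝔠⁽²⁾`), constant `L²·(…)`.
* §6 (v1.1) `ofBlocks_loc_le_ofSup_self`, ★★ `hasMaj_cNormR_neg_two_of_hasMaj_pinLenInv` — the KERNEL FORM of LOCATED-U6 (`BH13-UNITS-MEMO.md`): a member INTO the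
  `(Lʲη)⁻¹`-weighted graded pin (P2) is a member INTO `𝔠^{(−2)}` of the site carrier with majorant `(w s)⁻¹·K` — `R∇\*_UG₁` would have to gain `(Lʲη)²`, print gives `(Lʲη)¹`.
HONEST SCOPE.  Bookkeeping over landed objects; the sup and gradient members are HYPOTHESES of printed species ((3.42)₁,₂, (3.44)-type), nothing of [B9]∕[4] is asserted;
no pin, no certificate edit; the constants (`r_near + 2(d+1)L² + 2`, `coordBound·Σ‖b_c‖`) are ours and not optimised; COUNT-NEUTRAL; N06 NOT discharged; one finite torus
at a time — nothing continuum, nothing about OS positivity or the mass gap.  Cell `pub-ymgap` (HUMAN RULING D-0062), Track A node N06 [B9], seat `pub-ymgap-dag-n06-l` (g24), 2026-08-29.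
-/

noncomputable section

namespace Literature.MathematicalPhysics.QuantumFieldTheory.Balaban1983to89.B9SmoothHolderClassTFromGradient

open B4TorusKernel.MultiPeriod (torusSupNorm torusSupNorm_nonneg)
open B6GlobalChartV1 (PV blkV1 boxEquiv boxEquiv_apply toBox_apply val_boxEquiv_symm)
open B6Geom246MultiLevelBox (blkOf)
open B6Geom246MultiLevelTorus (bondT geomT torusSupNorm_neg)
open B6Ineq2142KLevelV1 (β lvl)
open B6KLevelCensusIndexV1 (KIdx)
open B6Prop22KLevelTorusCensusEta (nKT one_le_nKT nKT_pos)
open B6LowerBound2153Torus (rep)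
open B6BlockDecayHprimeCovV1 (torusSupNorm_rep_sub_rep)
open B9GeoNormsKLevelV1 (geo9K geo9K_len_kGeo)
open B9GeoLemma21KLevelV1 (geo9K_dist_triangle geo9K_len_pos geo9K_dist_eq)
open B9Thm34Ext (toB6)
open B9Thm39ReadingCoords (coordBound39 basisBound39 abs_repr_le)
open B11SectG (BlockNorm HasMaj)
open B9SectDSup (weightNorm weightNorm_loc)
open B11SectGGlobal (Size)
open B11SectGGlobalSizes
open B11SectGSmoothCutT (Size.ofPairsT ofPairsT_sz_le)
open B9Thm312WholeClasses (cNormR cNormR_loc)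
open B9Eq39Adjoint (R covD)
open B9BackgroundsKLevelV1 (shiftsV1)
open B9Eq340StepLasso (rungSites taxiSteps)
open B9Eq340TaxiTelescope (supDist_rungSites_taxiSteps_le)
open B9Eq340CovariantLipschitzY (norm_R_parSY_sub_le length_taxiSteps_le_mul_pdist pdist_pos_of_ne)
open B9Eq340HolderLipParSymY (covD_comp_boxEquiv pdist_comm)
open B9CoReadingCoords (XBK blkBK assembleK norm_le_basisBound_mul)
open B9CoReadingCoordsS (XSK sIK blkSK)
open B9GradViaDivLettersTransported (taxiS)
open B9GradViaDivLettersAtPinsHolderPairs (sIK_chartY)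
open B9MultiscaleSmoothPartitionY (scl scl_pos NearY levY_window levY_window_of_nearY levY_eq_blkOf)
open B9MultiscaleSmoothPartitionYNear (rNear rNear_nonneg distT_carrier_blkOf_le_of_nearY)
open B9SmoothHolderClassS (NearPair wEta wEta_nonneg Wscl Wscl_nonneg scl_div_nKT_pos_le_one one_le_Wscl)
open B9SmoothHolderClassT (trDif trDif_apply bHZT bHZT_loc)
open B9SmoothHolderClassTClosure (abs_cf_eq_nKT len_eq_scl_div len_le_one len_rpow_neg_eq_Wscl hasMaj_ofBlocks_of_cNormR abs_apply_le_of_hasMaj_cNormR)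
open Node00 (SiteY FBondY IBondY toKT levY CfgY parSY cdS)
open Node00.OpsYHolderFar (pdist pdist_nonneg)
open Node00.OpsYNablaBridge (chartY chartY_eq gradY_apply_eq_cdS)
open Node00.OpsYSectDCoords (DvcoKH)
open LatticeFieldCalculus (supDist)
open T4RelativeLadder (UnitaryLike)
open B9SmoothHolderClassTGradientTools (cast_supDist_boxEquiv_symm nKT_mul_pdist wEta_eq_inv_rpow_pdist abs_trDif_taxiS_le lvl_sIK_eq_levY
  lvl_bI_rung_window dist_bI_rung_le len_rpow_le_of_lvl_window)

variable {d ℓ : ℕ} {hd : 1 ≤ d + 1} {hL : Odd (ℓ + 1) ∧ 1 < ℓ + 1} {b₀ b₁ : ℝ}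
variable {𝔸 : Type} [NormedRing 𝔸] [NormedAlgebra ℂ 𝔸]
variable {κ : Type} [Fintype κ]
variable (i : KIdx d ℓ hd hL b₀ b₁)
/-! ## §4 ★★★ A sup member plus a GRADIENT member give a member INTO the transported site class -/

section Main

variable [Fintype (geo9K i).Site] [CompleteSpace 𝔸] [FiniteDimensional ℝ 𝔸] (b : Module.Basis κ ℝ 𝔸) (B : B9.Backgrounds) (cfg : B.Cfg → CfgY 𝔸 i)
variable {R : ℝ} {H : Prop} (hlen : ∀ y : (geo9K i).Site, 0 ≤ (geo9K i).len y) {bI : FBondY i → IBondY i}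
variable {F₁ : Type} [AddCommGroup F₁] [Module ℝ F₁]

/-- ★★★ **INTO THE TRANSPORTED SITE CLASS FROM A SUP MEMBER AND A GRADIENT MEMBER (the covariant telescope, no probe family).**  For ANY source class `b₁`,
exponents `0 ≤ ε ≤ 1`, `ε ≤ p`, a target length power `t`, and def-Y's taxicab table `taxiS U` of a configuration with unitary-like bond variables: if
`T : b₁ → 𝔠^{(−h)}` on the site carrier (blocks `sIK bI`, `h − p = t`; value bound `|Tμ| ≤ (Lʲη)^h·C₀e^{−δd}`) and `D_U∘T : b₁ → 𝔠^{(−g)}` on the bond carrier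
(blocks `bI`, `(1−ε) + g = t`; `|D_U Tμ| ≤ (Lʲη)^g·C₁e^{−δd}`, the gradient model `DvcoKH`), then `T` is bounded INTO `bHZT (taxiS U) ε p` with majorant
`(L^{|h|}C₀e^{δr} + L^{(1−ε)+2|g|}(d+1)·c_b·C₁e^{δr₂})·(Lʲη)^t·e^{−δd}`, `c_b = coordBound·Σ‖b_c‖`.  SUP PART: as `…TClosure` §4 (enlarged block one level away,
radius `r`).  PAIR PART: for a near pair `(z, z′)` based in `Δ̃(y)`, `(η|z−z′|_T)^{−ε}|repr_c(Ψ(z) − R(U(Γ_{z,z′}))Ψ(z′))| ≤ (η|z−z′|_T)^{1−ε}·(d+1)·c_b·max_{rungs}|D_UΨ|`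
(telescope along `Γ_{z,z′}`, `|Γ| ≤ (d+1)|z−z′|_T`, `|c_f| = Lᵏ` cancels the lattice-unit `η⁻¹`), the rung bonds lie within `r₂` of `y` and two levels of `j(y)`, and
`η|z−z′|_T ≤ L·Lʲ⁽ʸ⁾η`: the HONEST GAIN `(L·Lʲη)^{1−ε}` of print's (3.43) (`(Lʲη)^{1−β}`) is kept.  Binders: the certificate's `hlev`, radii `hN ∕ hN₂` (discharged in §5),
print's units `hcf`. [cite: Balaban1985BackgroundPropagators, (3.40) p.397 + (3.42)–(3.43) pp.397–398 + (3.3) p.391 + p.423 (mean-value step); Balaban1984PropagatorsII, (2.51)–(2.54) pp.232–233, (2.1)–(2.2) p.224] -/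
theorem hasMaj_into_bHZT_of_grad {ε p : ℝ} (hε0 : 0 ≤ ε) (hε1 : ε ≤ 1) (hεp : ε ≤ p) {t h g : ℝ} (hht : h - p = t) (hgt : (1 - ε) + g = t)
    (hlev : ∀ f : FBondY i, lvl i.hN i.D i.hk (bI f) = (blkV1 i.hN i.D f).1.1)
    {r r₂ δ : ℝ} (hδ : 0 ≤ δ) (hN : ∀ (y : IBondY i) (z : SiteY i), NearY i y z → (geo9K i).dist y (sIK i bI z) ≤ r)
    (hN₂ : ∀ (y : IBondY i) (z : SiteY i) (w : Site (PV d ℓ i.m i.K hd hL) 0) (μ : Fin (d + 1)), NearY i y z →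
      ((supDist ((boxEquiv i.hN).symm z) w : ℕ) : ℝ) ≤ (((ℓ + 1 : ℕ) : ℝ)) ^ levY i z → (geo9K i).dist y (bI ⟨w, μ⟩) ≤ r₂)
    (hcf : |i.cf| = (nKT (toKT i) : ℝ)) {U : B.Cfg} (hU : ∀ ν x, UnitaryLike (cfg U ν x))
    {b₁ : BlockNorm (toB6 (geo9K i) R H) F₁} {T : F₁ →ₗ[ℝ] (XSK κ i → ℝ)} {C₀ C₁ : ℝ} (hC₀ : 0 ≤ C₀) (hC₁ : 0 ≤ C₁)
    (hsup : HasMaj b₁ (cNormR R H (blkSK i (sIK i bI)) hlen (-h)) T (fun a a' => C₀ * Real.exp (-(δ * (geo9K i).dist a a'))))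
    (hgrad : HasMaj b₁ (cNormR R H (blkBK i bI) hlen (-g)) (DvcoKH i b B cfg U ∘ₗ T) (fun a a' => C₁ * Real.exp (-(δ * (geo9K i).dist a a')))) :
    HasMaj b₁ (bHZT (κ := κ) i b (taxiS i B cfg U) (R := R) (H := H) hε0 hε1 hεp) T
      (fun y y' => ((((ℓ + 1 : ℕ) : ℝ)) ^ |h| * C₀ * Real.exp (δ * r) +
          (((ℓ + 1 : ℕ) : ℝ)) ^ ((1 - ε) + 2 * |g|) * (((d : ℝ) + 1) * (coordBound39 b * basisBound39 b)) * C₁ * Real.exp (δ * r₂)) *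
        (geo9K i).len y ^ t * Real.exp (-(δ * (geo9K i).dist y y'))) := by
  classical
  intro y' μ hμ y
  rw [bHZT_loc]
  -- notation and signs
  set L : ℝ := ((ℓ + 1 : ℕ) : ℝ) with hLdef
  have hL1 : 1 ≤ L := by rw [hLdef]; exact_mod_cast Nat.succ_le_succ (Nat.zero_le ℓ)
  have hL0 : 0 < L := lt_of_lt_of_le one_pos hL1
  set Λ : ℝ := (geo9K i).len y with hΛdef
  have hΛ : 0 < Λ := geo9K_len_pos i y
  set E : ℝ := Real.exp (-(δ * (geo9K i).dist y y')) with hE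
  have hl0 : 0 ≤ b₁.loc y' μ := b₁.loc_nonneg _ _
  have hcb : 0 ≤ coordBound39 b * basisBound39 b := mul_nonneg (norm_nonneg _) (Finset.sum_nonneg fun _ _ => norm_nonneg _)
  have hn : (0 : ℝ) < (nKT (toKT i) : ℝ) := by exact_mod_cast nKT_pos (toKT i)
  -- moving a kernel from a block within `ρ` of `y` to `y` ([4] (2.54))
  have hmove : ∀ (ρ : ℝ) (y'' : IBondY i), (geo9K i).dist y y'' ≤ ρ →
      Real.exp (-(δ * (geo9K i).dist y'' y')) ≤ Real.exp (δ * ρ) * E := by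
    intro ρ y'' hρ
    rw [hE, ← Real.exp_add]
    refine Real.exp_le_exp.2 ?_
    nlinarith [mul_le_mul_of_nonneg_left (geo9K_dist_triangle i y y'' y') hδ, mul_le_mul_of_nonneg_left hρ hδ]
  -- THE SUP PART, value by value
  set KS : ℝ := L ^ |h| * C₀ * Real.exp (δ * r) with hKS
  have hKS0 : 0 ≤ KS := by positivity
  have hpt : ∀ q : XSK κ i, NearY i y q.1 → |T μ q| ≤ KS * Λ ^ h * E * b₁.loc y' μ := by
    intro q hq
    have hv := abs_apply_le_of_hasMaj_cNormR i hlen hsup hμ q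
    have hblk : blkSK i (sIK i bI) q = sIK i bI q.1 := rfl
    rw [hblk, Real.rpow_neg (hlen _), inv_inv] at hv
    have hwin := levY_window_of_nearY i hq
    rw [← lvl_sIK_eq_levY i hlev q.1] at hwin
    have hw1 := len_rpow_le_of_lvl_window i hcf (n := 1) hwin.2 hwin.1 h
    rw [Nat.cast_one, one_mul] at hw1
    have he := hmove r (sIK i bI q.1) (hN y q.1 hq)
    calc |T μ q| ≤ (geo9K i).len (sIK i bI q.1) ^ h * (C₀ * Real.exp (-(δ * (geo9K i).dist (sIK i bI q.1) y'))) * b₁.loc y' μ := hv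
      _ ≤ (L ^ |h| * Λ ^ h) * (C₀ * (Real.exp (δ * r) * E)) * b₁.loc y' μ :=
          mul_le_mul_of_nonneg_right (mul_le_mul hw1 (mul_le_mul_of_nonneg_left he hC₀) (by positivity) (by positivity)) hl0
      _ = KS * Λ ^ h * E * b₁.loc y' μ := by rw [hKS]; ring
  have hsupPart : Wscl i p y * (Size.ofSup (toB6 (geo9K i) R H) (fun (q : XSK κ i) (y : IBondY i) => NearY i y q.1)).sz y (T μ) ≤
      KS * Λ ^ t * E * b₁.loc y' μ := by
    have h1 : (Size.ofSup (toB6 (geo9K i) R H) (fun (q : XSK κ i) (y : IBondY i) => NearY i y q.1)).sz y (T μ) ≤ KS * Λ ^ h * E * b₁.loc y' μ :=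
      ofSup_sz_le _ (by positivity) fun q hq => hpt q hq
    have hW : Wscl i p y = Λ ^ (-p) := by rw [hΛdef, len_rpow_neg_eq_Wscl i hcf]
    calc Wscl i p y * _ ≤ Wscl i p y * (KS * Λ ^ h * E * b₁.loc y' μ) := mul_le_mul_of_nonneg_left h1 (Wscl_nonneg i p y)
      _ = KS * (Λ ^ (-p) * Λ ^ h) * E * b₁.loc y' μ := by rw [hW]; ring
      _ = KS * Λ ^ t * E * b₁.loc y' μ := by rw [← Real.rpow_add hΛ, ← hht]; ring_nf
  -- THE PAIR PART, near pair by near pair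
  set KP : ℝ := L ^ ((1 - ε) + 2 * |g|) * (((d : ℝ) + 1) * (coordBound39 b * basisBound39 b)) * C₁ * Real.exp (δ * r₂) with hKP
  have hKP0 : 0 ≤ KP := by positivity
  have hpair : ∀ q q' : XSK κ i, NearY i y q.1 → NearPair i q q' →
      wEta i ε q q' * |trDif b (taxiS i B cfg U) q q' (T μ)| ≤ KP * Λ ^ t * E * b₁.loc y' μ := by
    intro q q' hq hqq
    obtain ⟨hne, hnear, -⟩ := hqq
    -- the rung-wise bound on the gradient model
    set Mg : ℝ := L ^ (2 * |g|) * Λ ^ g * (C₁ * (Real.exp (δ * r₂) * E)) * b₁.loc y' μ with hMg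
    have hMg0 : 0 ≤ Mg := by positivity
    have hxx' : ((supDist ((boxEquiv i.hN).symm q.1) ((boxEquiv i.hN).symm q'.1) : ℕ) : ℝ) ≤ L ^ levY i q.1 := by
      rw [cast_supDist_boxEquiv_symm]; exact hnear
    have hrung : ∀ r ∈ rungSites (taxiSteps (List.finRange (d + 1)) ((boxEquiv i.hN).symm q.1) ((boxEquiv i.hN).symm q'.1)) ((boxEquiv i.hN).symm q.1),
        ∀ c, |DvcoKH i b B cfg U (T μ) (⟨r.1, r.2.1⟩, q.2.1, c, q.2.2.2)| ≤ Mg := by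
      intro r hr c
      have hv := abs_apply_le_of_hasMaj_cNormR i hlen hgrad hμ (⟨r.1, r.2.1⟩, q.2.1, c, q.2.2.2)
      rw [LinearMap.comp_apply] at hv
      have hblk : blkBK i bI (⟨r.1, r.2.1⟩, q.2.1, c, q.2.2.2) = bI ⟨r.1, r.2.1⟩ := rfl
      rw [hblk, Real.rpow_neg (hlen _), inv_inv] at hv
      have hwr : ((supDist ((boxEquiv i.hN).symm q.1) r.1 : ℕ) : ℝ) ≤ L ^ levY i q.1 :=
        le_trans (by exact_mod_cast (supDist_rungSites_taxiSteps_le _ _ r hr).1) hxx'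
      have hwin := lvl_bI_rung_window i hlev hq hwr r.2.1
      have hw2 := len_rpow_le_of_lvl_window i hcf (n := 2) hwin.1 hwin.2 g
      rw [Nat.cast_ofNat] at hw2
      have he := hmove r₂ (bI ⟨r.1, r.2.1⟩) (hN₂ y q.1 r.1 r.2.1 hq hwr)
      calc |DvcoKH i b B cfg U (T μ) (⟨r.1, r.2.1⟩, q.2.1, c, q.2.2.2)|
          ≤ (geo9K i).len (bI ⟨r.1, r.2.1⟩) ^ g * (C₁ * Real.exp (-(δ * (geo9K i).dist (bI ⟨r.1, r.2.1⟩) y'))) * b₁.loc y' μ := hv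
        _ ≤ (L ^ (2 * |g|) * Λ ^ g) * (C₁ * (Real.exp (δ * r₂) * E)) * b₁.loc y' μ :=
            mul_le_mul_of_nonneg_right (mul_le_mul hw2 (mul_le_mul_of_nonneg_left he hC₁) (by positivity) (by positivity)) hl0
        _ = Mg := by rw [hMg]
    have htr := abs_trDif_taxiS_le i b B cfg hU (T μ) q q' hMg0 hrung
    -- the pair weight against the contour length: `(η|Δz|)^{−ε}·|Δz|_T·|c_f|⁻¹ = (η|Δz|)^{1−ε}`
    have hp0 : 0 < pdist i q.1 q'.1 := pdist_pos_of_ne i (fun h => hne (congrArg Subtype.val h))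
    have hpd : pdist i q.1 q'.1 ≤ L * Λ := by
      have h1 : (nKT (toKT i) : ℝ) * pdist i q.1 q'.1 ≤ L ^ levY i q.1 := by rw [nKT_mul_pdist]; exact hnear
      have h2 : L ^ levY i q.1 ≤ L ^ (lvl i.hN i.D i.hk y + 1) := pow_le_pow_right₀ hL1 (levY_window_of_nearY i hq).2
      have h3 : L ^ (lvl i.hN i.D i.hk y + 1) = L * ((nKT (toKT i) : ℝ) * Λ) := by
        rw [hΛdef, len_eq_scl_div i hcf, mul_div_cancel₀ _ hn.ne', scl, pow_succ, mul_comm]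
      nlinarith [h1.trans (h2.trans h3.le)]
    have hpow : pdist i q.1 q'.1 ^ (1 - ε) ≤ (L * Λ) ^ (1 - ε) := Real.rpow_le_rpow hp0.le hpd (by linarith)
    rw [wEta_eq_inv_rpow_pdist]
    have hwε : 0 ≤ (pdist i q.1 q'.1 ^ ε)⁻¹ := inv_nonneg.2 (Real.rpow_nonneg hp0.le _)
    have hcfn : (nKT (toKT i) : ℝ) * |i.cf|⁻¹ = 1 := by rw [hcf, mul_inv_cancel₀ hn.ne']
    have hq1ε : (pdist i q.1 q'.1 ^ ε)⁻¹ * pdist i q.1 q'.1 = pdist i q.1 q'.1 ^ (1 - ε) := by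
      rw [Real.rpow_sub hp0, Real.rpow_one, div_eq_mul_inv, mul_comm]
    have hsplit : (L * Λ) ^ (1 - ε) * Λ ^ g = L ^ (1 - ε) * Λ ^ t := by
      rw [Real.mul_rpow hL0.le hΛ.le, mul_assoc, ← Real.rpow_add hΛ, hgt]
    have hLpow : L ^ (1 - ε) * L ^ (2 * |g|) = L ^ ((1 - ε) + 2 * |g|) := by rw [← Real.rpow_add hL0]
    calc (pdist i q.1 q'.1 ^ ε)⁻¹ * |trDif b (taxiS i B cfg U) q q' (T μ)|
        ≤ (pdist i q.1 q'.1 ^ ε)⁻¹ * (coordBound39 b * ((((d : ℝ) + 1) * ((nKT (toKT i) : ℝ) * pdist i q.1 q'.1)) *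
            (|i.cf|⁻¹ * (basisBound39 b * Mg)))) := mul_le_mul_of_nonneg_left htr hwε
      _ = (((d : ℝ) + 1) * (coordBound39 b * basisBound39 b)) * ((nKT (toKT i) : ℝ) * |i.cf|⁻¹) *
            ((pdist i q.1 q'.1 ^ ε)⁻¹ * pdist i q.1 q'.1) * Mg := by ring
      _ = (((d : ℝ) + 1) * (coordBound39 b * basisBound39 b)) * pdist i q.1 q'.1 ^ (1 - ε) * Mg := by rw [hcfn, hq1ε, mul_one]
      _ ≤ (((d : ℝ) + 1) * (coordBound39 b * basisBound39 b)) * (L * Λ) ^ (1 - ε) * Mg :=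
          mul_le_mul_of_nonneg_right (mul_le_mul_of_nonneg_left hpow (by positivity)) hMg0
      _ = (((d : ℝ) + 1) * (coordBound39 b * basisBound39 b)) * C₁ * Real.exp (δ * r₂) * (L ^ (2 * |g|) * ((L * Λ) ^ (1 - ε) * Λ ^ g)) * E * b₁.loc y' μ := by
          rw [hMg]; ring
      _ = KP * Λ ^ t * E * b₁.loc y' μ := by rw [hsplit, hKP, ← hLpow]; ring
  have hpairPart : (Size.ofPairsT (toB6 (geo9K i) R H) (fun (q : XSK κ i) (y : IBondY i) => NearY i y q.1) (NearPair i) (wEta i ε)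
        (wEta_nonneg i ε) (trDif b (taxiS i B cfg U))).sz y (T μ) ≤ KP * Λ ^ t * E * b₁.loc y' μ :=
    ofPairsT_sz_le _ _ _ _ _ (by positivity) fun q q' hq hqq => hpair q q' hq hqq
  calc _ ≤ KS * Λ ^ t * E * b₁.loc y' μ + KP * Λ ^ t * E * b₁.loc y' μ := add_le_add hsupPart hpairPart
    _ = _ := by rw [hKS, hKP, hE]; ring

end Main

/-! ## §5 The radii discharged; the PRINT-WEIGHTED form `(Lʲη)^{s−1}‖·‖_{bHZT s s}`; the certificate's `(Lʲη)⁻¹`-weighted graded pin -/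

section Corollaries

variable [Fintype (geo9K i).Site] [CompleteSpace 𝔸] [FiniteDimensional ℝ 𝔸] (b : Module.Basis κ ℝ 𝔸) (B : B9.Backgrounds) (cfg : B.Cfg → CfgY 𝔸 i)
variable {R : ℝ} {H : Prop} (hlen : ∀ y : (geo9K i).Site, 0 ≤ (geo9K i).len y) {bI : FBondY i → IBondY i}
variable {F₁ : Type} [AddCommGroup F₁] [Module ℝ F₁]

/-- a member into `𝔠^{(a)}` is a member into `𝔠^{(a′)}` for `a ≤ a′` (`Lʲη ≤ 1`: the weight `(Lʲη)^{a′} ≤ (Lʲη)^a`).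
[cite: Balaban1984PropagatorsII, (2.1) p.224 («Lʲη ≦ 1») + (2.51) p.232, bookkeeping] -/
theorem hasMaj_cNormR_of_exponent_le (hcf : |i.cf| = (nKT (toKT i) : ℝ)) {X : Type} [Fintype X] {blk : X → IBondY i}
    {b₁ : BlockNorm (toB6 (geo9K i) R H) F₁} {S : F₁ →ₗ[ℝ] (X → ℝ)} {K : IBondY i → IBondY i → ℝ} {a a' : ℝ} (haa : a ≤ a')
    (h : HasMaj b₁ (cNormR R H blk hlen a) S K) : HasMaj b₁ (cNormR R H blk hlen a') S K := by
  intro y' μ hμ y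
  refine le_trans ?_ (h y' μ hμ y)
  rw [cNormR_loc, cNormR_loc]
  exact mul_le_mul_of_nonneg_right (Real.rpow_le_rpow_of_exponent_ge (geo9K_len_pos i y) (len_le_one i hcf y) haa)
    ((BlockNorm.ofBlocks (toB6 (geo9K i) R H) blk).loc_nonneg _ _)

/-- ★★ **§4 WITH THE RADII DISCHARGED** by LAYER B (dag-n06-w6 `dist_sIK_le_of_nearY`: `r = r_near + 1`) and §3 (`dist_bI_rung_le`: `r₂ = r_near + 2(d+1)L² + 2`):
binders = the certificate's `hβ1 hlev` + print's units. [cite: Balaban1985BackgroundPropagators, (3.40) p.397 + (3.42)–(3.43) pp.397–398; Balaban1984PropagatorsII, (2.46) p.231 + (2.51)–(2.54) pp.232–233] -/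
theorem hasMaj_into_bHZT_of_grad_near {ε p : ℝ} (hε0 : 0 ≤ ε) (hε1 : ε ≤ 1) (hεp : ε ≤ p) {t h g : ℝ} (hht : h - p = t) (hgt : (1 - ε) + g = t)
    (hβ1 : ∀ f : FBondY i, (geomT i.D).dist (β i.hN i.D i.hk (bI f)) (blkV1 i.hN i.D f) ≤ 1)
    (hlev : ∀ f : FBondY i, lvl i.hN i.D i.hk (bI f) = (blkV1 i.hN i.D f).1.1) {δ : ℝ} (hδ : 0 ≤ δ)
    (hcf : |i.cf| = (nKT (toKT i) : ℝ)) {U : B.Cfg} (hU : ∀ ν x, UnitaryLike (cfg U ν x))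
    {b₁ : BlockNorm (toB6 (geo9K i) R H) F₁} {T : F₁ →ₗ[ℝ] (XSK κ i → ℝ)} {C₀ C₁ : ℝ} (hC₀ : 0 ≤ C₀) (hC₁ : 0 ≤ C₁)
    (hsup : HasMaj b₁ (cNormR R H (blkSK i (sIK i bI)) hlen (-h)) T (fun a a' => C₀ * Real.exp (-(δ * (geo9K i).dist a a'))))
    (hgrad : HasMaj b₁ (cNormR R H (blkBK i bI) hlen (-g)) (DvcoKH i b B cfg U ∘ₗ T) (fun a a' => C₁ * Real.exp (-(δ * (geo9K i).dist a a')))) :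
    HasMaj b₁ (bHZT (κ := κ) i b (taxiS i B cfg U) (R := R) (H := H) hε0 hε1 hεp) T
      (fun y y' => ((((ℓ + 1 : ℕ) : ℝ)) ^ |h| * C₀ * Real.exp (δ * (rNear d ℓ + 1)) +
          (((ℓ + 1 : ℕ) : ℝ)) ^ ((1 - ε) + 2 * |g|) * (((d : ℝ) + 1) * (coordBound39 b * basisBound39 b)) * C₁ *
            Real.exp (δ * (rNear d ℓ + (2 * ((d : ℝ) + 1) * (((ℓ + 1 : ℕ) : ℝ)) ^ 2 + 2)))) *
        (geo9K i).len y ^ t * Real.exp (-(δ * (geo9K i).dist y y'))) :=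
  hasMaj_into_bHZT_of_grad i b B cfg hlen hε0 hε1 hεp hht hgt hlev hδ (fun _ _ hyz => B9MultiscaleSmoothPartitionYNear.dist_sIK_le_of_nearY i hβ1 hyz)
    (fun _ _ _ μ hyz hw => dist_bI_rung_le i hβ1 hyz hw μ) hcf hU hC₀ hC₁ hsup hgrad

/-- ★★★ **THE PRINT-WEIGHTED MEMBER (balanced channels): `T : b₁ → (Lʲη)^{s−1}·‖·‖_{bHZT (taxiS U) s s}` from a `𝔠^{(−1)}` sup member and a `𝔠⁽⁰⁾` gradient member.**
With the target weight `Wscl (1−s) = (Lʲη)^{s−1}` on the exponent-`s` class with sup power `s` — the size `(Lʲη)⁻¹·sup_{Δ̃(y)}|F| + (Lʲη)^{s−1}·‖F‖_{s,η}`, a unit of which is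
EXACTLY print's input functional `‖F‖^{ξ}_s + |F| ≤ 2·Lʲη` of (3.44)∕(3.45) — a sup member `|Tμ| ≤ (Lʲη)·C₀e^{−δd}` ((3.42)₂-type) and a gradient member `|D_UTμ| ≤ C₁e^{−δd}`
((3.44)-type) give the majorant `L·(C₀e^{δ(r_near+1)} + (d+1)c_b·C₁e^{δ(r_near+2(d+1)L²+2)})·e^{−δd}`, UNIFORM IN `s ∈ [0,1]` — this is (3.43) read as a class statement.
[cite: Balaban1985BackgroundPropagators, Thm 3.1 (3.43) p.398 («B₀(β)(Lʲη)^{1−β}») + (3.42) p.397 + (3.44)–(3.45) p.398 («‖λ‖^{ξ′}_ε + |λ|»); Balaban1984PropagatorsII, (2.51)–(2.54) pp.232–233] -/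
theorem hasMaj_into_bHZT_printWeight_of_grad {s : ℝ} (hs0 : 0 ≤ s) (hs1 : s ≤ 1)
    (hβ1 : ∀ f : FBondY i, (geomT i.D).dist (β i.hN i.D i.hk (bI f)) (blkV1 i.hN i.D f) ≤ 1)
    (hlev : ∀ f : FBondY i, lvl i.hN i.D i.hk (bI f) = (blkV1 i.hN i.D f).1.1) {δ : ℝ} (hδ : 0 ≤ δ)
    (hcf : |i.cf| = (nKT (toKT i) : ℝ)) {U : B.Cfg} (hU : ∀ ν x, UnitaryLike (cfg U ν x))
    {b₁ : BlockNorm (toB6 (geo9K i) R H) F₁} {T : F₁ →ₗ[ℝ] (XSK κ i → ℝ)} {C₀ C₁ : ℝ} (hC₀ : 0 ≤ C₀) (hC₁ : 0 ≤ C₁)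
    (hsup : HasMaj b₁ (cNormR R H (blkSK i (sIK i bI)) hlen (-1)) T (fun a a' => C₀ * Real.exp (-(δ * (geo9K i).dist a a'))))
    (hgrad : HasMaj b₁ (cNormR R H (blkBK i bI) hlen 0) (DvcoKH i b B cfg U ∘ₗ T) (fun a a' => C₁ * Real.exp (-(δ * (geo9K i).dist a a')))) :
    HasMaj b₁ (weightNorm (bHZT (κ := κ) i b (taxiS i B cfg U) (R := R) (H := H) (ε := s) (p := s) hs0 hs1 le_rfl) (Wscl i (1 - s))
        (Wscl_nonneg i (1 - s))) T
      (fun y y' => (((ℓ + 1 : ℕ) : ℝ)) * (C₀ * Real.exp (δ * (rNear d ℓ + 1)) +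
          (((d : ℝ) + 1) * (coordBound39 b * basisBound39 b)) * C₁ * Real.exp (δ * (rNear d ℓ + (2 * ((d : ℝ) + 1) * (((ℓ + 1 : ℕ) : ℝ)) ^ 2 + 2)))) *
        Real.exp (-(δ * (geo9K i).dist y y'))) := by
  have hL1 : (1 : ℝ) ≤ ((ℓ + 1 : ℕ) : ℝ) := by exact_mod_cast Nat.succ_le_succ (Nat.zero_le ℓ)
  have hgrad' : HasMaj b₁ (cNormR R H (blkBK i bI) hlen (-0)) (DvcoKH i b B cfg U ∘ₗ T) (fun a a' => C₁ * Real.exp (-(δ * (geo9K i).dist a a'))) := by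
    rw [neg_zero]; exact hgrad
  have hm := hasMaj_into_bHZT_of_grad_near i b B cfg hlen hs0 hs1 le_rfl (t := 1 - s) (h := 1) (g := 0) (by ring) (by ring) hβ1 hlev hδ hcf hU hC₀ hC₁
    hsup hgrad'
  set KK : ℝ := (((ℓ + 1 : ℕ) : ℝ)) ^ |(1 : ℝ)| * C₀ * Real.exp (δ * (rNear d ℓ + 1)) +
      (((ℓ + 1 : ℕ) : ℝ)) ^ ((1 - s) + 2 * |(0 : ℝ)|) * (((d : ℝ) + 1) * (coordBound39 b * basisBound39 b)) * C₁ *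
        Real.exp (δ * (rNear d ℓ + (2 * ((d : ℝ) + 1) * (((ℓ + 1 : ℕ) : ℝ)) ^ 2 + 2))) with hKK
  set KK' : ℝ := (((ℓ + 1 : ℕ) : ℝ)) * (C₀ * Real.exp (δ * (rNear d ℓ + 1)) +
      (((d : ℝ) + 1) * (coordBound39 b * basisBound39 b)) * C₁ * Real.exp (δ * (rNear d ℓ + (2 * ((d : ℝ) + 1) * (((ℓ + 1 : ℕ) : ℝ)) ^ 2 + 2)))) with hKK'
  have hb : KK ≤ KK' := by
    have hp : (((ℓ + 1 : ℕ) : ℝ)) ^ (1 - s) ≤ ((ℓ + 1 : ℕ) : ℝ) := by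
      conv_rhs => rw [← Real.rpow_one (((ℓ + 1 : ℕ) : ℝ))]
      exact Real.rpow_le_rpow_of_exponent_le hL1 (by linarith)
    have hc : 0 ≤ (((d : ℝ) + 1) * (coordBound39 b * basisBound39 b)) * C₁ *
        Real.exp (δ * (rNear d ℓ + (2 * ((d : ℝ) + 1) * (((ℓ + 1 : ℕ) : ℝ)) ^ 2 + 2))) :=
      mul_nonneg (mul_nonneg (mul_nonneg (by positivity) (mul_nonneg (norm_nonneg _) (Finset.sum_nonneg fun _ _ => norm_nonneg _))) hC₁) (Real.exp_nonneg _)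
    rw [hKK, hKK', abs_one, Real.rpow_one, abs_zero, mul_zero, add_zero]
    nlinarith [mul_le_mul_of_nonneg_right hp hc]
  intro y' μ hμ y
  have h1 := hm y' μ hμ y
  dsimp only at h1
  rw [weightNorm_loc]
  have hΛ : 0 < (geo9K i).len y := geo9K_len_pos i y
  have hW : Wscl i (1 - s) y * (geo9K i).len y ^ (1 - s) = 1 := by
    rw [← len_rpow_neg_eq_Wscl i hcf, Real.rpow_neg hΛ.le, inv_mul_cancel₀ (Real.rpow_pos_of_pos hΛ _).ne']
  have hE0 : 0 ≤ Real.exp (-(δ * (geo9K i).dist y y')) * b₁.loc y' μ := mul_nonneg (Real.exp_nonneg _) (b₁.loc_nonneg _ _)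
  calc Wscl i (1 - s) y * (bHZT (κ := κ) i b (taxiS i B cfg U) (R := R) (H := H) hs0 hs1 le_rfl).loc y (T μ)
      ≤ Wscl i (1 - s) y * (KK * (geo9K i).len y ^ (1 - s) * Real.exp (-(δ * (geo9K i).dist y y')) * b₁.loc y' μ) :=
        mul_le_mul_of_nonneg_left h1 (Wscl_nonneg i (1 - s) y)
    _ = (Wscl i (1 - s) y * (geo9K i).len y ^ (1 - s)) * KK * (Real.exp (-(δ * (geo9K i).dist y y')) * b₁.loc y' μ) := by ring
    _ = KK * (Real.exp (-(δ * (geo9K i).dist y y')) * b₁.loc y' μ) := by rw [hW, one_mul]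
    _ ≤ KK' * (Real.exp (-(δ * (geo9K i).dist y y')) * b₁.loc y' μ) := mul_le_mul_of_nonneg_right hb hE0
    _ = _ := by ring

/-- ★★ **THE CERTIFICATE'S GRADED `(Lʲη)⁻¹`-WEIGHTED PIN (P2)** `bH13 := weightNorm (bHZG (taxiS U) (p := 1) w) (Lʲη)⁻¹`: a `𝔠^{(−2)}` sup member (`|Tμ| ≤ (Lʲη)²·C₀e^{−δd}`)
and a `𝔠^{(−1)}` gradient member (`|D_UTμ| ≤ (Lʲη)·C₁e^{−δd}`) — the shape of the dimensionless words `T_b, T_b₂` of (3.131)∕(3.137) on `𝔠⁽²⁾` — give a member INTO the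
pin with majorant `L²·(C₀e^{δ(r_near+1)} + (d+1)c_b·C₁e^{δ(r_near+2(d+1)L²+2)})·e^{−δd}` for every weight function `0 ≤ w ≤ 1` (the exponent-s members are read at
`g = s` from the `𝔠^{(−1)}` one, `Lʲη ≤ 1`). [cite: Balaban1985BackgroundPropagators, Thm 3.12 p.423 + (3.131) p.422 + (3.137)–(3.138) p.423 + (3.42)–(3.44) pp.397–398; Balaban1984PropagatorsII, (2.51)–(2.54) pp.232–233] -/
theorem hasMaj_into_pinLenInv_of_grad (w : ℝ → ℝ) (hw0 : ∀ s, 0 ≤ w s) (hw1 : ∀ s, w s ≤ 1)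
    (hβ1 : ∀ f : FBondY i, (geomT i.D).dist (β i.hN i.D i.hk (bI f)) (blkV1 i.hN i.D f) ≤ 1)
    (hlev : ∀ f : FBondY i, lvl i.hN i.D i.hk (bI f) = (blkV1 i.hN i.D f).1.1) {δ : ℝ} (hδ : 0 ≤ δ)
    (hcf : |i.cf| = (nKT (toKT i) : ℝ)) {U : B.Cfg} (hU : ∀ ν x, UnitaryLike (cfg U ν x))
    {b₁ : BlockNorm (toB6 (geo9K i) R H) F₁} {T : F₁ →ₗ[ℝ] (XSK κ i → ℝ)} {C₀ C₁ : ℝ} (hC₀ : 0 ≤ C₀) (hC₁ : 0 ≤ C₁)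
    (hsup : HasMaj b₁ (cNormR R H (blkSK i (sIK i bI)) hlen (-2)) T (fun a a' => C₀ * Real.exp (-(δ * (geo9K i).dist a a'))))
    (hgrad : HasMaj b₁ (cNormR R H (blkBK i bI) hlen (-1)) (DvcoKH i b B cfg U ∘ₗ T) (fun a a' => C₁ * Real.exp (-(δ * (geo9K i).dist a a')))) :
    HasMaj b₁ (weightNorm (B9SmoothHolderClassGraded.bHZG (κ := κ) i b (taxiS i B cfg U) (R := R) (H := H) (p := 1) le_rfl w hw0 hw1)
        (fun y => ((geo9K i).len y)⁻¹) fun y => inv_nonneg.2 (hlen y)) T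
      (fun y y' => (((ℓ + 1 : ℕ) : ℝ)) ^ 2 * (C₀ * Real.exp (δ * (rNear d ℓ + 1)) +
          (((d : ℝ) + 1) * (coordBound39 b * basisBound39 b)) * C₁ * Real.exp (δ * (rNear d ℓ + (2 * ((d : ℝ) + 1) * (((ℓ + 1 : ℕ) : ℝ)) ^ 2 + 2)))) *
        Real.exp (-(δ * (geo9K i).dist y y'))) := by
  have hL1 : (1 : ℝ) ≤ ((ℓ + 1 : ℕ) : ℝ) := by exact_mod_cast Nat.succ_le_succ (Nat.zero_le ℓ)
  set K₀ : ℝ := (((ℓ + 1 : ℕ) : ℝ)) ^ 2 * (C₀ * Real.exp (δ * (rNear d ℓ + 1)) +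
      (((d : ℝ) + 1) * (coordBound39 b * basisBound39 b)) * C₁ * Real.exp (δ * (rNear d ℓ + (2 * ((d : ℝ) + 1) * (((ℓ + 1 : ℕ) : ℝ)) ^ 2 + 2)))) with hK₀
  have hcb : 0 ≤ (((d : ℝ) + 1) * (coordBound39 b * basisBound39 b)) * C₁ *
      Real.exp (δ * (rNear d ℓ + (2 * ((d : ℝ) + 1) * (((ℓ + 1 : ℕ) : ℝ)) ^ 2 + 2))) :=
    mul_nonneg (mul_nonneg (mul_nonneg (by positivity) (mul_nonneg (norm_nonneg _) (Finset.sum_nonneg fun _ _ => norm_nonneg _))) hC₁) (Real.exp_nonneg _)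
  have hK₀0 : 0 ≤ K₀ := by positivity
  -- every exponent-`s` member, with the s-uniform constant `K₀·(Lʲη)`
  have hmem : ∀ (s : ℝ) (hs0 : 0 < s) (hs1 : s < 1),
      HasMaj b₁ (bHZT (κ := κ) i b (taxiS i B cfg U) (R := R) (H := H) (ε := s) (p := 1) hs0.le hs1.le (hs1.le.trans le_rfl)) T
        (fun y y' => K₀ * (geo9K i).len y * Real.exp (-(δ * (geo9K i).dist y y'))) := by
    intro s hs0 hs1
    have hg := hasMaj_cNormR_of_exponent_le i hlen hcf (a := -1) (a' := -s) (by linarith) hgrad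
    refine (hasMaj_into_bHZT_of_grad_near i b B cfg hlen hs0.le hs1.le (hs1.le.trans le_rfl) (t := 1) (h := 2) (g := s) (by norm_num) (by ring)
      hβ1 hlev hδ hcf hU hC₀ hC₁ hsup hg).mono fun y y' => ?_
    rw [Real.rpow_one]
    refine mul_le_mul_of_nonneg_right (mul_le_mul_of_nonneg_right ?_ (hlen y)) (Real.exp_nonneg _)
    have h2 : (((ℓ + 1 : ℕ) : ℝ)) ^ |(2 : ℝ)| = (((ℓ + 1 : ℕ) : ℝ)) ^ (2 : ℕ) := by
      rw [abs_of_pos (by norm_num : (0 : ℝ) < 2)]; exact_mod_cast Real.rpow_natCast (((ℓ + 1 : ℕ) : ℝ)) 2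
    have hs' : (((ℓ + 1 : ℕ) : ℝ)) ^ ((1 - s) + 2 * |s|) ≤ (((ℓ + 1 : ℕ) : ℝ)) ^ (2 : ℕ) := by
      rw [abs_of_pos hs0]
      calc (((ℓ + 1 : ℕ) : ℝ)) ^ ((1 - s) + 2 * s) ≤ (((ℓ + 1 : ℕ) : ℝ)) ^ (2 : ℝ) := Real.rpow_le_rpow_of_exponent_le hL1 (by linarith)
        _ = _ := by exact_mod_cast Real.rpow_natCast (((ℓ + 1 : ℕ) : ℝ)) 2
    rw [h2, hK₀]
    nlinarith [mul_le_mul_of_nonneg_right hs' hcb]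
  -- into the graded class (weights `≤ 1`), then the `(Lʲη)⁻¹` target weight cancels the gained `Lʲη`
  have hG := B9SmoothHolderClassGraded.hasMaj_into_bHZG i b (p := 1) le_rfl w hw0 hw1 (taxiS i B cfg U)
    (K := fun _ y y' => K₀ * (geo9K i).len y * Real.exp (-(δ * (geo9K i).dist y y')))
    (K₀ := fun y y' => K₀ * (geo9K i).len y * Real.exp (-(δ * (geo9K i).dist y y')))
    (fun y y' => by have := hlen y; positivity) (fun s _ _ y y' => mul_le_of_le_one_left (by have := hlen y; positivity) (hw1 s)) hmem
  intro y' μ hμ y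
  rw [weightNorm_loc]
  have hΛ : 0 < (geo9K i).len y := geo9K_len_pos i y
  calc ((geo9K i).len y)⁻¹ * _ ≤ ((geo9K i).len y)⁻¹ * (K₀ * (geo9K i).len y * Real.exp (-(δ * (geo9K i).dist y y')) * b₁.loc y' μ) :=
        mul_le_mul_of_nonneg_left (hG y' μ hμ y) (inv_nonneg.2 hΛ.le)
    _ = (((geo9K i).len y)⁻¹ * (geo9K i).len y) * (K₀ * Real.exp (-(δ * (geo9K i).dist y y')) * b₁.loc y' μ) := by ring
    _ = _ := by rw [inv_mul_cancel₀ hΛ.ne', one_mul]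

end Corollaries

/-! ## §6 (v1.1) The units of the `(Lʲη)⁻¹`-weighted pin: a member INTO it is a member INTO the `(Lʲη)²`-gaining sup class (LOCATED-U6, kernel form) -/

section Units

variable [Fintype (geo9K i).Site] (b : Module.Basis κ ℝ 𝔸) (g : SiteY i → SiteY i → 𝔸ˣ)
variable {R : ℝ} {H : Prop} (hlen : ∀ y : (geo9K i).Site, 0 ≤ (geo9K i).len y) {bI : FBondY i → IBondY i}
variable {F₁ : Type} [AddCommGroup F₁] [Module ℝ F₁]

open Classical in
/-- the sharp-block sup over the block `y` of the site carrier (site-faithful block map) is below the `Δ̃(y)`-sup size AT THE SAME `y`.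
[cite: Balaban1985BackgroundPropagators, (3.43) p.398 («Δ̃(y) ⊃ Δ(y)»), bookkeeping] -/
theorem ofBlocks_loc_le_ofSup_self (hβS : ∀ z : SiteY i, β i.hN i.D i.hk (sIK i bI z) = blkOf i.D.toDomains z) (y : IBondY i) (F : XSK κ i → ℝ) :
    (BlockNorm.ofBlocks (toB6 (geo9K i) R H) (blkSK i (sIK i bI))).loc y F ≤
      (Size.ofSup (toB6 (geo9K i) R H) (fun (q : XSK κ i) (y : IBondY i) => NearY i y q.1)).sz y F := by
  show (⨆ q : XSK κ i, @ite ℝ (blkSK i (sIK i bI) q = y) (Classical.propDecidable _) |F q| 0) ≤ _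
  refine Real.iSup_le (fun q => ?_) (Size.nonneg _ _ _)
  split_ifs with hq
  · refine ofSup_abs_le _ (B9MultiscaleSmoothPartitionY.nearY_of_blkOf_eq i ?_) F
    rw [← hβS q.1]
    exact congrArg _ hq
  · exact Size.nonneg _ _ _

/-- ★★ **THE UNITS OF THE PIN (P2), KERNEL FORM OF LOCATED-U6.**  A member `T : b₁ → bH13` INTO the certificate's `(Lʲη)⁻¹`-weighted graded pin
`weightNorm (bHZG g (p:=1) w) (Lʲη)⁻¹` with a non-negative majorant `K` is, for every exponent `s` with `w s > 0`, a member INTO the sharp sup class `𝔠^{(−2)}` of the site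
carrier with majorant `(w s)⁻¹·K` (any `K`): `(Lʲη)^{−2}·sup_{Δ(y)}|Tμ| ≤ (w s)⁻¹·K(y,y′)·loc(μ)`, i.e. `T` GAINS `(Lʲη)²` in sup — for `T = R∇\*_UG₁` (`Letters313DZ.rgdH`, ED.52 :169) one power of
`Lʲη` beyond print's (3.42)₂ + (3.49) (`𝔠⁽⁰⁾ → 𝔠⁽¹⁾`, the certificate's own `rgd2`).  Reason: `loc_{bH13} = (Lʲη)⁻¹·loc_{bHZG} ≥ (Lʲη)⁻¹·w(s)·loc_{bHZT s 1} ≥ w(s)·(Lʲη)^{−2}·sup_{Δ̃(y)}`.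
[cite: Balaban1985BackgroundPropagators, (3.42) p.397 + (3.43) p.398 + (3.49) p.399 + Thm 3.13 (3.152) p.426; Balaban1984PropagatorsII, (2.51) p.232] -/
theorem hasMaj_cNormR_neg_two_of_hasMaj_pinLenInv (w : ℝ → ℝ) (hw0 : ∀ s, 0 ≤ w s) (hw1 : ∀ s, w s ≤ 1) {s : ℝ} (hs0 : 0 < s) (hs1 : s < 1) (hws : 0 < w s)
    (hβS : ∀ z : SiteY i, β i.hN i.D i.hk (sIK i bI z) = blkOf i.D.toDomains z) (hcf : |i.cf| = (nKT (toKT i) : ℝ))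
    {b₁ : BlockNorm (toB6 (geo9K i) R H) F₁} {T : F₁ →ₗ[ℝ] (XSK κ i → ℝ)} {K : IBondY i → IBondY i → ℝ}
    (h : HasMaj b₁ (weightNorm (B9SmoothHolderClassGraded.bHZG (κ := κ) i b g (R := R) (H := H) (p := 1) le_rfl w hw0 hw1)
      (fun y => ((geo9K i).len y)⁻¹) fun y => inv_nonneg.2 (hlen y)) T K) :
    HasMaj b₁ (cNormR R H (blkSK i (sIK i bI)) hlen (-2)) T (fun y y' => (w s)⁻¹ * K y y') := by
  classical
  intro y' μ hμ y
  have hΛ : 0 < (geo9K i).len y := geo9K_len_pos i y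
  have h1 := h y' μ hμ y
  rw [weightNorm_loc] at h1
  have h2 := B9SmoothHolderClassGraded.bHZT_loc_le_bHZG i b (R := R) (H := H) (p := 1) le_rfl w hw0 hw1 g hs0 hs1 hws y (T μ)
  have h3 : Wscl i 1 y * (Size.ofSup (toB6 (geo9K i) R H) (fun (q : XSK κ i) (y : IBondY i) => NearY i y q.1)).sz y (T μ) ≤
      (bHZT (κ := κ) i b g (R := R) (H := H) (ε := s) (p := 1) hs0.le hs1.le (hs1.le.trans le_rfl)).loc y (T μ) := by
    rw [bHZT_loc]; exact le_add_of_nonneg_right (Size.nonneg _ _ _)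
  have h4 := ofBlocks_loc_le_ofSup_self i (R := R) (H := H) hβS y (T μ)
  rw [← len_rpow_neg_eq_Wscl i hcf, Real.rpow_neg_one] at h3
  rw [cNormR_loc, show (-2 : ℝ) = -1 + -1 by norm_num, Real.rpow_add hΛ, Real.rpow_neg_one, mul_assoc]
  show _ ≤ (w s)⁻¹ * K y y' * b₁.loc y' μ
  calc ((geo9K i).len y)⁻¹ * (((geo9K i).len y)⁻¹ * (BlockNorm.ofBlocks (toB6 (geo9K i) R H) (blkSK i (sIK i bI))).loc y (T μ))
      ≤ ((geo9K i).len y)⁻¹ * ((w s)⁻¹ * (B9SmoothHolderClassGraded.bHZG (κ := κ) i b g (R := R) (H := H) (p := 1) le_rfl w hw0 hw1).loc y (T μ)) :=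
        mul_le_mul_of_nonneg_left (((mul_le_mul_of_nonneg_left h4 (inv_nonneg.2 hΛ.le)).trans h3).trans h2) (inv_nonneg.2 hΛ.le)
    _ = (w s)⁻¹ * (((geo9K i).len y)⁻¹ * (B9SmoothHolderClassGraded.bHZG (κ := κ) i b g (R := R) (H := H) (p := 1) le_rfl w hw0 hw1).loc y (T μ)) := by ring
    _ ≤ (w s)⁻¹ * (K y y' * b₁.loc y' μ) := mul_le_mul_of_nonneg_left h1 (inv_nonneg.2 hws.le)
    _ = _ := by ring

end Units

end Literature.MathematicalPhysics.QuantumFieldTheory.Balaban1983to89.B9SmoothHolderClassTFromGradient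

end
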